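import Summits.QuantumFields.QCD.Theorems.QuarksAsStableActionCriticalLineDiamagnetismCellSecondOrderAux1
import Summits.QuantumFields.QCD.Theorems.QuarksAsStableActionCriticalLineDiamagnetismCellInvert

/-!
# B6 cell sub-stub `cellSecondOrder`, Aux 4: colour triviality, the perturbation, and the second-order trace formula
(crux `stmt-QuantumFields-9734`, decl `Summit.QuantumFields.QCD.Theses.QuarksAsStableAction.CriticalLineDiamagnetism`,
line `Sketch`, Route B step B6; sub-problem context `Summits/QuantumFields/QCD/Statement.lean`)

* `D1_eq_reindex`: the free frequency operator is `sFree ⊗ 1₃` (colour-trivial), hence `G = D_1⁻¹ = sFree⁻¹ ⊗ 1₃` and its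
  colour–spin site blocks are `1₃ ⊗ freeBlock` (`block_D1_inv`);
* `DP_sub_D1_eq`: the checkerboard perturbation `Δ = D_P − D_1` is supported on the first-coordinate links, with blocks
  `−σ(x) (U_x − 1) ⊗ P₋²` at `(x, x+e₁)` and `−σ(x) (U_xᴴ − 1) ⊗ P₊²` at `(x+e₁, x)`, `U_x = chk n P x 2`;
* `colour_factor_le`: `|tr₃(C C′)| ≤ 2 def(P) [x odd row][x′ odd row]` for the colour matrices of two links;
* `trace_sandwich`: `Tr(A E_{yz}(K₁) B E_{y′z′}(K₂)) = tr(A(z′,y) K₁ B(z,y′) K₂)`;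
* registered `cellWalkTrace`: `|Tr X²| ≤ 2 def(P) Σ_{x,x′} [x odd][x′ odd] pairAbs x′ x`.
-/

noncomputable section

open scoped BigOperators Matrix Kronecker ComplexConjugate Matrix.Norms.L2Operator
open Matrix Literature.MathematicalPhysics.QuantumLattice
open Summit.QuantumFields.QCD.Cruxes.CriticalLineDiamagnetism.ChessboardCellGain.CellKappa
open Summit.QuantumFields.QCD.Cruxes.CriticalLineDiamagnetism.ChessboardCellGain.FrequencyDiamagnetism
open Summit.QuantumFields.QCD.Cruxes.CriticalLineDiamagnetism.ChessboardCellGain.Cell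

namespace Summit.QuantumFields.QCD.Cruxes.CriticalLineDiamagnetism.ChessboardCellGain.CellWalk

variable {n : ℕ}

/-! ### Colour triviality of the free operator -/

/-- `x + e₁` in coordinates. -/
theorem prod_add_e1 (x : ZMod (2 * n) × ZMod (2 * n)) : x + (1, 0) = (x.1 + 1, x.2) := Prod.ext rfl (add_zero _)

/-- `x + e₂` in coordinates. -/
theorem prod_add_e2 (x : ZMod (2 * n) × ZMod (2 * n)) : x + (0, 1) = (x.1, x.2 + 1) := Prod.ext (add_zero _) rfl

/-- Splitting a conjunction indicator into a product of indicators. -/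
theorem onsite_term (p q : Prop) [Decidable p] [Decidable q] (E : ℂ) :
    (if p ∧ q then E else 0) = (if p then 1 else 0) * E * (if q then 1 else 0) := by
  by_cases hp : p <;> by_cases hq : q <;> simp [hp, hq]

/-- Normal form of a `(1 − γ)` hop entry. -/
theorem hop_term_sub (p : Prop) [Decidable p] (a g σ δ : ℂ) :
    (if p then (a - g) * (σ * δ) else 0) = 2 * (((if p then σ else 0) * (1 / 2 * (a - g))) * δ) := by
  split_ifs <;> ring

/-- Normal form of a `(1 + γ)` hop entry. -/
theorem hop_term_add (p : Prop) [Decidable p] (a g σ δ : ℂ) :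
    (if p then (a + g) * (σ * δ) else 0) = 2 * (((if p then σ else 0) * (1 / 2 * (a + g))) * δ) := by
  split_ifs <;> ring

variable [NeZero n]

/-- **Colour triviality of the free operator**: `D_1 = sFree ⊗ 1₃` along `csEquiv`. -/
theorem D1_eq_reindex (m ω₀ ω₁ : ℝ) :
    D1 n m ω₀ ω₁ = Matrix.reindex (csEquiv _) (csEquiv _)
      (sFree (2 * n) (bigM m ω₀ ω₁) (Real.sin ω₀) (Real.sin ω₁) ⊗ₖ (1 : Matrix (Fin 3) (Fin 3) ℂ)) := by
  ext ⟨x, c, i⟩ ⟨y, c', k⟩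
  simp only [D1, freqOpR, Matrix.of_apply, Matrix.reindex_apply, Matrix.submatrix_apply, csEquiv, Equiv.coe_fn_symm_mk,
    Matrix.kroneckerMap_apply, sFree, sHopTot, dirHop, spinN, bigM, Matrix.sub_apply, Matrix.add_apply,
    Matrix.smul_apply, Matrix.one_apply, smul_eq_mul, pMinus, pPlus, prod_add_e1, prod_add_e2, OneMemClass.coe_one,
    star_one, seam, onsite_term, hop_term_sub, hop_term_add]
  ring


/-! ### the free propagator is colour-trivial -/

/-- `G = D_1⁻¹ = sFree⁻¹ ⊗ 1₃` along `csEquiv`. -/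
theorem D1_inv_eq_reindex (m ω₀ ω₁ : ℝ) :
    (D1 n m ω₀ ω₁)⁻¹ = Matrix.reindex (csEquiv _) (csEquiv _)
      ((sFree (2 * n) (bigM m ω₀ ω₁) (Real.sin ω₀) (Real.sin ω₁))⁻¹ ⊗ₖ (1 : Matrix (Fin 3) (Fin 3) ℂ)) := by
  rw [D1_eq_reindex, Matrix.inv_reindex, Matrix.inv_kronecker, inv_one]

/-- The colour-spin site blocks of `G`: `G(u, v) = 1₃ ⊗ g(u, v)` with `g = freeBlock`. -/
theorem block_D1_inv (m ω₀ ω₁ : ℝ) (u v : ZMod (2 * n) × ZMod (2 * n)) :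
    (Matrix.of fun a b : Fin 3 × Fin 4 => (D1 n m ω₀ ω₁)⁻¹ (u, a) (v, b)) =
      (1 : Matrix (Fin 3) (Fin 3) ℂ) ⊗ₖ freeBlock (2 * n) (bigM m ω₀ ω₁) (Real.sin ω₀) (Real.sin ω₁) u v := by
  rw [D1_inv_eq_reindex]
  ext ⟨c, i⟩ ⟨c', k⟩
  simp [csEquiv, Matrix.kroneckerMap_apply, freeBlock, mul_comm]

/-! ### the perturbation `Δ = D_P − D_1` is supported on the first-coordinate links -/

omit [NeZero n] in
/-- Collapsing the forward single-site indicator sum. -/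
theorem sum_single_fwd {α : Type} [AddCommMonoid α] (f : ZMod (2 * n) × ZMod (2 * n) → α)
    (p₁ q₁ e : ZMod (2 * n) × ZMod (2 * n)) [NeZero n] :
    (∑ x, if x = p₁ ∧ x + e = q₁ then f x else 0) = if q₁ = p₁ + e then f p₁ else 0 := by
  rw [Finset.sum_eq_single p₁]
  · by_cases h : q₁ = p₁ + e
    · rw [if_pos ⟨rfl, h.symm⟩, if_pos h]
    · rw [if_neg (fun h' => h h'.2.symm), if_neg h]
  · intro x _ hx; rw [if_neg (fun h' => hx h'.1)]
  · intro h; exact absurd (Finset.mem_univ _) h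

omit [NeZero n] in
/-- Collapsing the backward single-site indicator sum. -/
theorem sum_single_bwd {α : Type} [AddCommMonoid α] (f : ZMod (2 * n) × ZMod (2 * n) → α)
    (p₁ q₁ e : ZMod (2 * n) × ZMod (2 * n)) [NeZero n] :
    (∑ x, if x + e = p₁ ∧ x = q₁ then f x else 0) = if p₁ = q₁ + e then f q₁ else 0 := by
  rw [Finset.sum_eq_single q₁]
  · by_cases h : p₁ = q₁ + e
    · rw [if_pos ⟨h.symm, rfl⟩, if_pos h]
    · rw [if_neg (fun h' => h h'.1.symm), if_neg h]
  · intro x _ hx; rw [if_neg (fun h' => hx h'.2)]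
  · intro h; exact absurd (Finset.mem_univ _) h

omit [NeZero n] in
/-- Moving an indicator outside a product. -/
theorem mul_indicator_mul (a b : ℂ) (c : Prop) [Decidable c] :
    a * ((if c then (1 : ℂ) else 0) * b) = if c then a * b else 0 := by
  split_ifs <;> simp

omit [NeZero n] in
/-- An indicator times a triple product. -/
theorem ite_mul3 (p : Prop) [Decidable p] (a b c : ℂ) :
    (if p then a * (b * c) else 0) = (if p then 1 else 0) * (a * (b * c)) := by
  split_ifs <;> simp

/-- **The perturbation**: `D_P − D_1 = Δ_fwd + Δ_bwd`, the forward blocks `−σ(x) (U_x − 1) ⊗ P₋²` at `(x, x + e₁)` and the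
backward blocks `−σ(x) (U_xᴴ − 1) ⊗ P₊²` at `(x + e₁, x)`, `U_x = chk n P x 2`. -/
theorem DP_sub_D1_eq (P : Matrix.unitaryGroup (Fin 3) ℂ) (m ω₀ ω₁ : ℝ) :
    DP n P m ω₀ ω₁ - D1 n m ω₀ ω₁ =
      (∑ x : ZMod (2 * n) × ZMod (2 * n), (-seam x.1) •
        (Matrix.single x (x + (1, 0)) (1 : ℂ) ⊗ₖ
          ((((chk n P x.1 x.2 2 : Matrix.unitaryGroup (Fin 3) ℂ) : Matrix (Fin 3) (Fin 3) ℂ) - 1) ⊗ₖ pMinus 2))) +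
      ∑ x : ZMod (2 * n) × ZMod (2 * n), (-seam x.1) •
        (Matrix.single (x + (1, 0)) x (1 : ℂ) ⊗ₖ
          ((star ((chk n P x.1 x.2 2 : Matrix.unitaryGroup (Fin 3) ℂ) : Matrix (Fin 3) (Fin 3) ℂ) - 1) ⊗ₖ pPlus 2)) := by
  ext ⟨x, c, i⟩ ⟨y, c', k⟩
  simp only [DP, D1, freqOpR, Matrix.of_apply, Matrix.sub_apply, Matrix.add_apply, Matrix.sum_apply, Matrix.smul_apply,
    Matrix.kroneckerMap_apply, Matrix.single_apply, cellDefs_anchor, OneMemClass.coe_one, star_one, smul_eq_mul,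
    mul_indicator_mul]
  rw [sum_single_fwd, sum_single_bwd]
  simp only [prod_add_e1, seam, pMinus, pPlus, Matrix.smul_apply, Matrix.sub_apply, Matrix.add_apply, Matrix.one_apply,
    smul_eq_mul, ite_mul3]
  ring

/-! ### the colour factor -/

omit [NeZero n] in
/-- The plaquette deficit is nonnegative. -/
theorem defi_nonneg (P : Matrix.unitaryGroup (Fin 3) ℂ) : 0 ≤ defi P := by
  have h := frobenius_sq_isometry_sub_one (P : Matrix (Fin 3) (Fin 3) ℂ) (Matrix.UnitaryGroup.star_mul_self P)
  have h0 : (0 : ℝ) ≤ ∑ c, ∑ d, ‖((P : Matrix (Fin 3) (Fin 3) ℂ) - 1) c d‖ ^ 2 := by positivity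
  rw [defi]; linarith

omit [NeZero n] in
/-- `|tr(C C′)| ≤ ½ (‖C‖_F² + ‖C′‖_F²)`. -/
theorem norm_trace_mul_le_frob (C C' : Matrix (Fin 3) (Fin 3) ℂ) :
    ‖(C * C').trace‖ ≤ ((∑ c, ∑ d, ‖C c d‖ ^ 2) + ∑ c, ∑ d, ‖C' c d‖ ^ 2) / 2 := by
  rw [Matrix.trace]
  simp only [Matrix.diag, Matrix.mul_apply]
  calc ‖∑ c, ∑ d, C c d * C' d c‖ ≤ ∑ c, ‖∑ d, C c d * C' d c‖ := norm_sum_le _ _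
    _ ≤ ∑ c, ∑ d, ‖C c d * C' d c‖ := Finset.sum_le_sum fun c _ => norm_sum_le _ _
    _ ≤ ∑ c, ∑ d, (‖C c d‖ ^ 2 + ‖C' d c‖ ^ 2) / 2 := by
      refine Finset.sum_le_sum fun c _ => Finset.sum_le_sum fun d _ => ?_
      rw [norm_mul]
      nlinarith [two_mul_le_add_sq ‖C c d‖ ‖C' d c‖]
    _ = ((∑ c, ∑ d, ‖C c d‖ ^ 2) + ∑ c, ∑ d, ‖C' c d‖ ^ 2) / 2 := by
      have hc : (∑ c, ∑ d, ‖C' d c‖ ^ 2 : ℝ) = ∑ c, ∑ d, ‖C' c d‖ ^ 2 := Finset.sum_comm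
      rw [show (fun c => ∑ d, (‖C c d‖ ^ 2 + ‖C' d c‖ ^ 2) / 2) =
          fun c => ((∑ d, ‖C c d‖ ^ 2) + ∑ d, ‖C' d c‖ ^ 2) / 2 from
        funext fun c => by rw [← Finset.sum_div, Finset.sum_add_distrib]]
      rw [← Finset.sum_div, Finset.sum_add_distrib, hc]

omit [NeZero n] in
/-- A matrix with vanishing Frobenius norm vanishes. -/
theorem eq_zero_of_frob_le_zero (D : Matrix (Fin 3) (Fin 3) ℂ) (h : (∑ c, ∑ d, ‖D c d‖ ^ 2 : ℝ) ≤ 0) : D = 0 := by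
  ext c d
  have h3 : ‖D c d‖ ^ 2 ≤ ∑ c', ∑ d', ‖D c' d'‖ ^ 2 := by
    calc ‖D c d‖ ^ 2 ≤ ∑ d', ‖D c d'‖ ^ 2 :=
          Finset.single_le_sum (f := fun d' => ‖D c d'‖ ^ 2) (fun _ _ => by positivity) (Finset.mem_univ d)
      _ ≤ ∑ c', ∑ d', ‖D c' d'‖ ^ 2 :=
          Finset.single_le_sum (f := fun c' => ∑ d', ‖D c' d'‖ ^ 2) (fun _ _ => by positivity) (Finset.mem_univ c)
  have h4 : ‖D c d‖ = 0 := by nlinarith [norm_nonneg (D c d)]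
  simpa using h4

omit [NeZero n] in
/-- The two Frobenius norms: `‖P − 1‖_F² = ‖Pᴴ − 1‖_F² = 2 def(P)`. -/
theorem frob_sq_sub_one (P : Matrix.unitaryGroup (Fin 3) ℂ) :
    (∑ c, ∑ d, ‖((P : Matrix (Fin 3) (Fin 3) ℂ) - 1) c d‖ ^ 2 : ℝ) = 2 * defi P ∧
    (∑ c, ∑ d, ‖(star (P : Matrix (Fin 3) (Fin 3) ℂ) - 1) c d‖ ^ 2 : ℝ) = 2 * defi P := by
  have h1 : (P : Matrix (Fin 3) (Fin 3) ℂ)ᴴ * (P : Matrix (Fin 3) (Fin 3) ℂ) = 1 := Matrix.UnitaryGroup.star_mul_self P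
  have h2 : (star (P : Matrix (Fin 3) (Fin 3) ℂ))ᴴ * star (P : Matrix (Fin 3) (Fin 3) ℂ) = 1 := by
    rw [Matrix.star_eq_conjTranspose, Matrix.conjTranspose_conjTranspose]
    exact Unitary.coe_mul_star_self P
  refine ⟨by rw [frobenius_sq_isometry_sub_one _ h1, defi], ?_⟩
  rw [frobenius_sq_isometry_sub_one _ h2, defi, Matrix.star_eq_conjTranspose, Matrix.trace_conjTranspose,
    Complex.star_def, Complex.conj_re]

omit [NeZero n] in
/-- **The colour factor.**  For the colour matrices `C, C′ ∈ {U_x − 1, U_xᴴ − 1}` of two checkerboard links,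
`|tr(C C′)| ≤ 2 def(P) [x odd row] [x′ odd row]`. -/
theorem colour_factor_le (P : Matrix.unitaryGroup (Fin 3) ℂ) (x x' : ZMod (2 * n) × ZMod (2 * n))
    (C C' : Matrix (Fin 3) (Fin 3) ℂ)
    (hC : C = ((chk n P x.1 x.2 2 : Matrix.unitaryGroup (Fin 3) ℂ) : Matrix (Fin 3) (Fin 3) ℂ) - 1 ∨
      C = star ((chk n P x.1 x.2 2 : Matrix.unitaryGroup (Fin 3) ℂ) : Matrix (Fin 3) (Fin 3) ℂ) - 1)
    (hC' : C' = ((chk n P x'.1 x'.2 2 : Matrix.unitaryGroup (Fin 3) ℂ) : Matrix (Fin 3) (Fin 3) ℂ) - 1 ∨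
      C' = star ((chk n P x'.1 x'.2 2 : Matrix.unitaryGroup (Fin 3) ℂ) : Matrix (Fin 3) (Fin 3) ℂ) - 1) :
    ‖(C * C').trace‖ ≤ 2 * defi P * (if x.2.val % 2 = 1 then 1 else 0) * (if x'.2.val % 2 = 1 then 1 else 0) := by
  have hd := defi_nonneg P
  have hfro : ∀ (y : ZMod (2 * n) × ZMod (2 * n)) (D : Matrix (Fin 3) (Fin 3) ℂ),
      (D = ((chk n P y.1 y.2 2 : Matrix.unitaryGroup (Fin 3) ℂ) : Matrix (Fin 3) (Fin 3) ℂ) - 1 ∨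
        D = star ((chk n P y.1 y.2 2 : Matrix.unitaryGroup (Fin 3) ℂ) : Matrix (Fin 3) (Fin 3) ℂ) - 1) →
      (∑ c, ∑ d, ‖D c d‖ ^ 2 : ℝ) ≤ 2 * defi P * (if y.2.val % 2 = 1 then 1 else 0) := by
    intro y D hD
    by_cases hy : y.2.val % 2 = 1
    · rw [if_pos hy, mul_one]
      have hchk : chk n P y.1 y.2 2 = P ∨ chk n P y.1 y.2 2 = P⁻¹ := by
        unfold chk; rw [if_pos ⟨rfl, hy⟩]; split_ifs <;> simp
      have hP := frob_sq_sub_one P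
      have hPi := frob_sq_sub_one P⁻¹
      have hdefi : defi P⁻¹ = defi P := by
        rw [defi, defi, Matrix.UnitaryGroup.inv_apply, Matrix.star_eq_conjTranspose, Matrix.trace_conjTranspose,
          Complex.star_def, Complex.conj_re]
      rcases hchk with h | h <;> rw [h] at hD <;> rcases hD with rfl | rfl
      · exact hP.1.le
      · exact hP.2.le
      · rw [hdefi] at hPi; exact hPi.1.le
      · rw [hdefi] at hPi; exact hPi.2.le
    · rw [if_neg hy, mul_zero]
      have hchk : chk n P y.1 y.2 2 = 1 := by
        unfold chk; rw [if_neg (fun h => hy h.2)]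
      rw [hchk] at hD
      simp only [OneMemClass.coe_one, star_one, sub_self, or_self] at hD
      subst hD
      simp
  have h1 := hfro x C hC
  have h2 := hfro x' C' hC'
  have h := norm_trace_mul_le_frob C C'
  -- if either indicator vanishes, the corresponding matrix vanishes
  by_cases hx : x.2.val % 2 = 1 <;> by_cases hx' : x'.2.val % 2 = 1 <;>
    simp only [hx, hx', if_true, if_false, mul_one, mul_zero] at h1 h2 ⊢
  · linarith
  · rw [eq_zero_of_frob_le_zero C' h2]; simp
  · rw [eq_zero_of_frob_le_zero C h1]; simp
  · rw [eq_zero_of_frob_le_zero C h1]; simp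


/-! ### traces of sandwiched single-site blocks -/

section Sandwich

variable {T K : Type} [Fintype T] [DecidableEq T] [Fintype K]

omit [NeZero n] in
/-- Entries of `A · (E_{yz} ⊗ K₁)`. -/
theorem mul_single_kron_apply (A : Matrix (T × K) (T × K) ℂ) (y z : T) (K₁ : Matrix K K ℂ) (p q : T × K) :
    (A * (Matrix.single y z (1 : ℂ) ⊗ₖ K₁)) p q = if q.1 = z then ∑ k, A p (y, k) * K₁ k q.2 else 0 := by
  simp only [Matrix.mul_apply, Matrix.kroneckerMap_apply, Matrix.single_apply, Fintype.sum_prod_type]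
  by_cases h : q.1 = z
  · rw [if_pos h, Finset.sum_eq_single y]
    · simp [h]
    · intro r _ hr; simp [Ne.symm hr]
    · intro hh; exact absurd (Finset.mem_univ _) hh
  · rw [if_neg h]
    refine Finset.sum_eq_zero fun r _ => Finset.sum_eq_zero fun k _ => ?_
    rw [if_neg (fun h' => h h'.2.symm)]; simp

omit [NeZero n] in
/-- **Trace of two sandwiched single-site blocks**:
`Tr(A E_{y z}(K₁) B E_{y′ z′}(K₂)) = tr(A(z′, y) K₁ B(z, y′) K₂)` with the `K × K` site blocks `A(u, v)`. -/
theorem trace_sandwich (A B : Matrix (T × K) (T × K) ℂ) (y z y' z' : T) (K₁ K₂ : Matrix K K ℂ) :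
    Matrix.trace ((A * (Matrix.single y z (1 : ℂ) ⊗ₖ K₁)) * (B * (Matrix.single y' z' (1 : ℂ) ⊗ₖ K₂))) =
      Matrix.trace (((Matrix.of fun a b : K => A (z', a) (y, b)) * K₁) *
        ((Matrix.of fun a b : K => B (z, a) (y', b)) * K₂)) := by
  simp only [Matrix.trace, Matrix.diag, Matrix.mul_apply, Matrix.of_apply]
  simp only [← Matrix.mul_apply, mul_single_kron_apply]
  rw [Fintype.sum_prod_type, Finset.sum_eq_single z']
  · refine Finset.sum_congr rfl fun a _ => ?_
    rw [Fintype.sum_prod_type, Finset.sum_eq_single z]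
    · simp only [if_true]
    · intro r _ hr; simp [hr]
    · intro hh; exact absurd (Finset.mem_univ _) hh
  · intro p _ hp; simp [hp]
  · intro hh; exact absurd (Finset.mem_univ _) hh

end Sandwich

/-! ### the second-order trace -/

/-- One sandwiched term, evaluated and bounded: with `G(u,v) = 1 ⊗ g(u,v)` and `K = C ⊗ B`,
`|Tr(G E(K₁) G E(K₂))| = |tr(C₁C₂)| |tr(g B₁ g B₂)|`. -/
theorem norm_trace_term_eq (m ω₀ ω₁ : ℝ) (y z y' z' : ZMod (2 * n) × ZMod (2 * n))
    (C₁ C₂ : Matrix (Fin 3) (Fin 3) ℂ) (B₁ B₂ : Matrix (Fin 4) (Fin 4) ℂ) :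
    ‖Matrix.trace (((D1 n m ω₀ ω₁)⁻¹ * (Matrix.single y z (1 : ℂ) ⊗ₖ (C₁ ⊗ₖ B₁))) *
        ((D1 n m ω₀ ω₁)⁻¹ * (Matrix.single y' z' (1 : ℂ) ⊗ₖ (C₂ ⊗ₖ B₂))))‖ =
      ‖(C₁ * C₂).trace‖ *
        ‖(freeBlock (2 * n) (bigM m ω₀ ω₁) (Real.sin ω₀) (Real.sin ω₁) z' y * B₁ *
          freeBlock (2 * n) (bigM m ω₀ ω₁) (Real.sin ω₀) (Real.sin ω₁) z y' * B₂).trace‖ := by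
  rw [trace_sandwich, block_D1_inv, block_D1_inv, ← mul_kronecker_mul, ← mul_kronecker_mul, ← mul_kronecker_mul,
    Matrix.one_mul, Matrix.one_mul, Matrix.trace_kronecker, norm_mul]
  simp only [Matrix.mul_assoc]

/-- **The second-order trace is controlled by the pair bubbles**:
`|Tr X²| ≤ 2 def(P) Σ_{x, x′ odd rows} pairAbs x′ x`. -/
theorem norm_trace_X_sq_le (P : Matrix.unitaryGroup (Fin 3) ℂ) (m ω₀ ω₁ : ℝ) :
    ‖((X n P m ω₀ ω₁) ^ 2).trace‖ ≤ 2 * defi P * ∑ x : ZMod (2 * n) × ZMod (2 * n), ∑ x' : ZMod (2 * n) × ZMod (2 * n),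
      (if x.2.val % 2 = 1 then (1 : ℝ) else 0) * (if x'.2.val % 2 = 1 then (1 : ℝ) else 0) *
        pairAbs (2 * n) (bigM m ω₀ ω₁) (Real.sin ω₀) (Real.sin ω₁) x' x := by
  -- notation
  set G := (D1 n m ω₀ ω₁)⁻¹ with hG
  set U : ZMod (2 * n) × ZMod (2 * n) → Matrix (Fin 3) (Fin 3) ℂ :=
    fun x => ((chk n P x.1 x.2 2 : Matrix.unitaryGroup (Fin 3) ℂ) : Matrix (Fin 3) (Fin 3) ℂ) with hU
  set Ef : ZMod (2 * n) × ZMod (2 * n) → Matrix ((ZMod (2 * n) × ZMod (2 * n)) × Fin 3 × Fin 4)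
      ((ZMod (2 * n) × ZMod (2 * n)) × Fin 3 × Fin 4) ℂ :=
    fun x => Matrix.single x (x + (1, 0)) (1 : ℂ) ⊗ₖ ((U x - 1) ⊗ₖ pMinus 2) with hEf
  set Eb : ZMod (2 * n) × ZMod (2 * n) → Matrix ((ZMod (2 * n) × ZMod (2 * n)) × Fin 3 × Fin 4)
      ((ZMod (2 * n) × ZMod (2 * n)) × Fin 3 × Fin 4) ℂ :=
    fun x => Matrix.single (x + (1, 0)) x (1 : ℂ) ⊗ₖ ((star (U x) - 1) ⊗ₖ pPlus 2) with hEb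
  set A := ∑ x, (-seam x.1) • (G * Ef x) with hA
  set Bm := ∑ x, (-seam x.1) • (G * Eb x) with hB
  have hX : X n P m ω₀ ω₁ = A + Bm := by
    rw [X, DP_sub_D1_eq, Matrix.mul_add, Matrix.mul_sum, Matrix.mul_sum]
    simp only [Matrix.mul_smul]
    rfl
  set g := freeBlock (2 * n) (bigM m ω₀ ω₁) (Real.sin ω₀) (Real.sin ω₁) with hg
  set ind : ZMod (2 * n) × ZMod (2 * n) → ℝ := fun x => if x.2.val % 2 = 1 then 1 else 0 with hind
  -- the generic term bound
  have hseam : ∀ a : ZMod (2 * n), ‖-seam a‖ = 1 := by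
    intro a; rw [norm_neg]; unfold seam; split_ifs <;> simp
  have key : ∀ (x x' y z y' z' : ZMod (2 * n) × ZMod (2 * n)) (C₁ C₂ : Matrix (Fin 3) (Fin 3) ℂ)
      (B₁ B₂ : Matrix (Fin 4) (Fin 4) ℂ),
      (C₁ = U x - 1 ∨ C₁ = star (U x) - 1) → (C₂ = U x' - 1 ∨ C₂ = star (U x') - 1) →
      ‖Matrix.trace (((-seam x.1) • (G * (Matrix.single y z (1 : ℂ) ⊗ₖ (C₁ ⊗ₖ B₁)))) *
          ((-seam x'.1) • (G * (Matrix.single y' z' (1 : ℂ) ⊗ₖ (C₂ ⊗ₖ B₂)))))‖ ≤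
        2 * defi P * ind x * ind x' * ‖(g z' y * B₁ * g z y' * B₂).trace‖ := by
    intro x x' y z y' z' C₁ C₂ B₁ B₂ hC₁ hC₂
    rw [Matrix.smul_mul, Matrix.mul_smul, smul_smul, Matrix.trace_smul, smul_eq_mul, norm_mul, norm_mul, hseam, hseam,
      one_mul, one_mul, hG, norm_trace_term_eq]
    exact mul_le_mul_of_nonneg_right (colour_factor_le P x x' C₁ C₂ hC₁ hC₂) (norm_nonneg _)
  -- expansion of the four products
  have hexp : ∀ (E₁ E₂ : ZMod (2 * n) × ZMod (2 * n) → Matrix ((ZMod (2 * n) × ZMod (2 * n)) × Fin 3 × Fin 4)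
      ((ZMod (2 * n) × ZMod (2 * n)) × Fin 3 × Fin 4) ℂ),
      Matrix.trace ((∑ x, (-seam x.1) • (G * E₁ x)) * (∑ x, (-seam x.1) • (G * E₂ x))) =
        ∑ x, ∑ x', Matrix.trace (((-seam x.1) • (G * E₁ x)) * ((-seam x'.1) • (G * E₂ x'))) := by
    intro E₁ E₂
    rw [Finset.sum_mul_sum, Matrix.trace_sum]
    exact Finset.sum_congr rfl fun x _ => Matrix.trace_sum _ _
  have hbound : ∀ (E₁ E₂ : ZMod (2 * n) × ZMod (2 * n) → Matrix ((ZMod (2 * n) × ZMod (2 * n)) × Fin 3 × Fin 4)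
      ((ZMod (2 * n) × ZMod (2 * n)) × Fin 3 × Fin 4) ℂ) (b : ZMod (2 * n) × ZMod (2 * n) → ZMod (2 * n) × ZMod (2 * n) → ℝ),
      (∀ x x', ‖Matrix.trace (((-seam x.1) • (G * E₁ x)) * ((-seam x'.1) • (G * E₂ x')))‖ ≤ b x x') →
      ‖Matrix.trace ((∑ x, (-seam x.1) • (G * E₁ x)) * (∑ x, (-seam x.1) • (G * E₂ x)))‖ ≤ ∑ x, ∑ x', b x x' := by
    intro E₁ E₂ b hb
    rw [hexp]
    refine (norm_sum_le _ _).trans (Finset.sum_le_sum fun x _ => (norm_sum_le _ _).trans (Finset.sum_le_sum fun x' _ => hb x x'))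
  have hff := hbound Ef Ef (fun x x' => 2 * defi P * ind x * ind x' * ‖(g (x' + (1, 0)) x * pMinus 2 * g (x + (1, 0)) x' * pMinus 2).trace‖)
    (fun x x' => key x x' x (x + (1, 0)) x' (x' + (1, 0)) _ _ _ _ (Or.inl rfl) (Or.inl rfl))
  have hfb := hbound Ef Eb (fun x x' => 2 * defi P * ind x * ind x' * ‖(g x' x * pMinus 2 * g (x + (1, 0)) (x' + (1, 0)) * pPlus 2).trace‖)
    (fun x x' => key x x' x (x + (1, 0)) (x' + (1, 0)) x' _ _ _ _ (Or.inl rfl) (Or.inr rfl))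
  have hbf := hbound Eb Ef (fun x x' => 2 * defi P * ind x * ind x' * ‖(g (x' + (1, 0)) (x + (1, 0)) * pPlus 2 * g x x' * pMinus 2).trace‖)
    (fun x x' => key x x' (x + (1, 0)) x x' (x' + (1, 0)) _ _ _ _ (Or.inr rfl) (Or.inl rfl))
  have hbb := hbound Eb Eb (fun x x' => 2 * defi P * ind x * ind x' * ‖(g x' (x + (1, 0)) * pPlus 2 * g x (x' + (1, 0)) * pPlus 2).trace‖)
    (fun x x' => key x x' (x + (1, 0)) x (x' + (1, 0)) x' _ _ _ _ (Or.inr rfl) (Or.inr rfl))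
  rw [hX, sq, Matrix.add_mul, Matrix.mul_add, Matrix.mul_add, Matrix.trace_add, Matrix.trace_add, Matrix.trace_add]
  calc _ ≤ ‖(A * A).trace‖ + ‖(A * Bm).trace‖ + (‖(Bm * A).trace‖ + ‖(Bm * Bm).trace‖) := by
        refine (norm_add_le _ _).trans (add_le_add (norm_add_le _ _) (norm_add_le _ _))
    _ ≤ _ := by
      refine (add_le_add (add_le_add hff hfb) (add_le_add hbf hbb)).trans (le_of_eq ?_)
      rw [Finset.mul_sum, ← Finset.sum_add_distrib, ← Finset.sum_add_distrib, ← Finset.sum_add_distrib]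
      refine Finset.sum_congr rfl fun x _ => ?_
      rw [Finset.mul_sum, ← Finset.sum_add_distrib, ← Finset.sum_add_distrib, ← Finset.sum_add_distrib]
      refine Finset.sum_congr rfl fun x' _ => ?_
      rw [pairAbs]
      ring




/-! ### Registered summary -/

/-- **Aux theorem `cellWalkTrace`** (registered helper of `cellSecondOrder`): the second-order trace of the checkerboard
perturbation is controlled by the pair bubbles of the free spin-site propagator, `|Tr X²| ≤ 2 def(P) Σ [x odd][x′ odd]
pairAbs x′ x` (no hypothesis on the parameters: a purely algebraic consequence of colour triviality, the link support of
`Δ`, and the Frobenius bound on the colour traces). -/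
theorem cellWalkTrace : ∀ (n : ℕ) [NeZero n] (P : Matrix.unitaryGroup (Fin 3) ℂ) (m ω₀ ω₁ : ℝ), ‖((X n P m ω₀ ω₁) ^ 2).trace‖ ≤ 2 * defi P * ∑ x : ZMod (2 * n) × ZMod (2 * n), ∑ x' : ZMod (2 * n) × ZMod (2 * n), (if x.2.val % 2 = 1 then (1 : ℝ) else 0) * (if x'.2.val % 2 = 1 then (1 : ℝ) else 0) * pairAbs (2 * n) (bigM m ω₀ ω₁) (Real.sin ω₀) (Real.sin ω₁) x' x :=
  fun _ _ P m ω₀ ω₁ => norm_trace_X_sq_le P m ω₀ ω₁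

end Summit.QuantumFields.QCD.Cruxes.CriticalLineDiamagnetism.ChessboardCellGain.CellWalk

end
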